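import Summits.KontsevichZagierPeriods.Zeta5Search.Denom.TwoTaleD1Inclusion
import Summits.KontsevichZagierPeriods.Zeta5Search.TwoTaleD1Decay
import Summits.KontsevichZagierPeriods.Zeta5Search.TwoTaleD1GrowthEnclosure
import HarnessLib

/-!
# RUNG D1 = L(1/3): the irrationality exponent of `ζ(2) = π²/6` is at most `5.0205` (file T10 of the D1 note)

HONEST FRAMING: systematic search; no irrationality claim unless certified.  This file asserts nothing about `ζ(5)`.
It draws together, with NO hypothesis, three tree theorems of the D1 = L(1/3) programme of cell pub-zeta5 (two-tale
point `a = (19n+1, 16n+1, 13n+1, 22n+1)`, `b = (1, 3n+1, 6n+1, 38n+2)` of [Zudilin 2014, §3] with its Remark-5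
partner; design `families/denom/D1-DESIGN-NOTE.md` (fam-denom) + `families/measure/D1-DECAYT-DESIGN.md` (fam-measure) +
`pub-zeta5-p1/D1-TALE1-g12.md` (P1)):

* fam-denom's rung theorem with the inclusion DISCHARGED, `Denom.TwoTaleD1Inclusion.zetaTwo_exponent_le_D1 :
  DecayD1 42.33437 → CoeffRateD1 C₁ → 0 < C₁ → C₁ ≤ 60.808 → ExponentLE (zetaValue 2) 5.0205` — Zudilin's Lemma 7
  digit cells for `q_n, p_n`, Lemma 8 cells at the partner transported by the ladder identity `(bmiss)`
  (`TwoTaleOmega.OmegaLadder.bmiss_D1`, from cert-2's `OmegaBmiss`), the normaliser `D₂₂ₙ D₂₃ₙ` and the certified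
  saving rate `23.20999 ≤ S ≤ 23.21011` (`Denom.TwoTaleD1Saving`), composed through the generic
  `exponentLE_of_normalisedForms`;
* P1's tale-1 DECAY `TwoTaleD1Line.decayD1_holds_sharp : DecayD1 42.33437` (vertical-line representation, strip shift
  to `x = ⌊15n/2⌋`, termwise line rate, and the `decide +kernel` two-point certificate `profileD1_le … ≤ −42.33438`);
* P1's coefficient GROWTH `TwoTaleD1Growth.coeffRateD1_holds : CoeffRateD1 C₁starD1` with `C₁starD1_pos` and the
  kernel enclosure `C₁starD1_le' : C₁starD1 ≤ 60.808` (Whipple `q_n = −q̂_n`, one-signed binomial sum, Laplace squeeze).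

RESULT: `zetaTwo_exponent_le_D1 : ExponentLE (zetaValue 2) 5.0205`, restated in Mathlib terms only as
`pi_sq_div_six_not_liouvilleWith_D1 : ∀ p > 5.0205, ¬ LiouvilleWith p (π²/6)` (via `ζ(2) = π²/6`, Mathlib
`hasSum_zeta_two`).  Kernel arithmetic behind the constant (F2): `1 + (60.808 + 45 − 23.20999)/(42.33437 − 45 +
23.20999) = 5.020472 ≤ 5.0205` (design value `5.02045247`).

READING / CAVEATS (to be worded by the referee, R6(e); R-D1″ (α)(β)(γ) were met before this file was filed): a
measure bound for the KNOWN-IRRATIONAL number `π²`, not an irrationality proof, with no bearing on `ζ(5)`; it lies below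
the tree's P15 bound `5.0499` (`TwoTaleP15Measure.zetaTwo_exponent_le_P15`, three derivations) and the printed record
`5.095412` of [Zudilin 2014, Thm 1] [cite: Zudilin2014ZetaTwo, Theorem 1]; the [Zu14] inputs are the tree's own
kernel-checked formalisations (the paper is cited for provenance); the human-readable proof must be written and refereed
before prose claims; `5.0205` is the constant of the D1 design as filed, not optimised (fam-measure g8: the next rungs of
the ladder `L(s)` move the third decimal only at `s = 2/5`).
-/

namespace Summit.KontsevichZagierPeriods.Zeta5Search.TwoTaleD1Measure

open Literature.NumberTheory.Transcendental (zetaValue)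

/-- **`μ(ζ(2)) ≤ 5.0205`**: the irrationality exponent of `ζ(2)` is at most `5.0205`, with no hypothesis —
`ExponentLE ξ κ := ∀ p, κ < p → ¬ LiouvilleWith p ξ` (`MeasureRecords`).  Rung D1 = L(1/3) of the two-tale ladder
(see the module docstring); below the printed record `5.095412` [cite: Zudilin2014ZetaTwo, Theorem 1]. -/
theorem zetaTwo_exponent_le_D1 : ExponentLE (zetaValue 2) 5.0205 :=
  Denom.TwoTaleD1Inclusion.zetaTwo_exponent_le_D1 TwoTaleD1Line.decayD1_holds_sharp
    TwoTaleD1Growth.coeffRateD1_holds TwoTaleD1Growth.C₁starD1_pos TwoTaleD1Growth.C₁starD1_le'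

/-- **`μ(π²/6) ≤ 5.0205` in Mathlib terms only** (junk-value-free restatement): for every real `p > 5.0205`,
`π²/6` is not Liouville with exponent `p`. [cite: Zudilin2014ZetaTwo, Theorem 1] -/
theorem pi_sq_div_six_not_liouvilleWith_D1 :
    ∀ p : ℝ, (5.0205 : ℝ) < p → ¬ LiouvilleWith p (Real.pi ^ 2 / 6) := by
  intro p hp
  have h2 : zetaValue 2 = Real.pi ^ 2 / 6 := by rw [zetaValue]; exact hasSum_zeta_two.tsum_eq
  rw [← h2]
  exact zetaTwo_exponent_le_D1 p hp

/-- `μ(π²) ≤ 5.0205` as well (`LiouvilleWith` is invariant under multiplication by a nonzero rational, Mathlib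
`LiouvilleWith.mul_rat_iff`). -/
theorem pi_sq_not_liouvilleWith_D1 : ∀ p : ℝ, (5.0205 : ℝ) < p → ¬ LiouvilleWith p (Real.pi ^ 2) := by
  intro p hp h
  refine pi_sq_div_six_not_liouvilleWith_D1 p hp ?_
  have e : Real.pi ^ 2 / 6 = Real.pi ^ 2 * ((1 / 6 : ℚ) : ℝ) := by push_cast; ring
  rw [e, LiouvilleWith.mul_rat_iff (by norm_num)]
  exact h

/-!
## Restatements over Mathlib's `riemannZeta` (append, measure-writer g5, 2026-08-25)

For the standalone write-up `papers/KontsevichZagierPeriods/zeta2-measure/`: the bound `μ(ζ(2)) ≤ 5.0205` stated with Mathlib's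
`riemannZeta` in place of the tree's real series `zetaValue 2`, so that an outside reader can check the `ζ(2)` form of the
statement against Mathlib alone (`riemannZeta`, `Complex.re`, `LiouvilleWith`, numerals) — exactly as the `π²` form
`pi_sq_not_liouvilleWith_D1` already can be.  No new mathematics: `Literature.NumberTheory.Transcendental.ofReal_zetaValue`
(`(zetaValue k : ℂ) = riemannZeta k` for `1 < k`, from Mathlib's `zeta_nat_eq_tsum_of_gt_one`) and `Complex.ofReal_re`.
HONEST FRAMING: a measure bound for the known-irrational `ζ(2) = π²/6`; nothing about `ζ(5)`.
-/

open Literature.NumberTheory.Transcendental (ofReal_zetaValue) in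
/-- **`μ(ζ(2)) ≤ 5.0205` over Mathlib's `riemannZeta`**: for every real `p > 5.0205`, the real part of `riemannZeta 2`
(which is the real number `ζ(2) = π²/6`, Mathlib `riemannZeta_two`) is not Liouville with exponent `p`.  Every symbol
under the statement is Mathlib's.  Below the printed record `5.095412` [cite: Zudilin2014ZetaTwo, Theorem 1]. -/
theorem riemannZeta_two_re_not_liouvilleWith_D1 :
    ∀ p : ℝ, (5.0205 : ℝ) < p → ¬ LiouvilleWith p (riemannZeta 2).re := by
  intro p hp
  have h : (riemannZeta 2).re = zetaValue 2 := by
    rw [show (2 : ℂ) = ((2 : ℕ) : ℂ) by norm_num, ← ofReal_zetaValue (by norm_num), Complex.ofReal_re]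
  rw [h]
  exact zetaTwo_exponent_le_D1 p hp

/-- The same without `Complex.re`: any real number `x` whose complex coercion is `riemannZeta 2` (there is exactly one,
`x = π²/6`) is not Liouville with any exponent `p > 5.0205`. [cite: Zudilin2014ZetaTwo, Theorem 1] -/
theorem not_liouvilleWith_of_ofReal_eq_riemannZeta_two_D1 :
    ∀ p : ℝ, (5.0205 : ℝ) < p → ∀ x : ℝ, (x : ℂ) = riemannZeta 2 → ¬ LiouvilleWith p x := by
  intro p hp x hx
  have e : x = (riemannZeta 2).re := by rw [← hx, Complex.ofReal_re]
  rw [e]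
  exact riemannZeta_two_re_not_liouvilleWith_D1 p hp

/-!
## Theorem 1.1 of the write-up, second sentence, verbatim (append, measure-writer g6, 2026-08-25)

For the standalone write-up `papers/KontsevichZagierPeriods/zeta2-measure/` (Theorem 1.1: «for every `p > 5.0205` and every
`C > 0` there are only finitely many pairs `(m,n) ∈ ℤ × ℕ` with `0 < |π² − m/n| < C n^{−p}`; and the same holds for `π²/6`»):
that sentence AS STATED — a `Set.Finite` over `ℤ × ℕ` in the vocabulary `Real.pi`, `|·|`, `rpow`, numerals — derived from
`pi_sq_not_liouvilleWith_D1` and Mathlib's definition of `LiouvilleWith` alone (unfold; the pairs with `n` below the threshold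
have `m` in a bounded integer interval; `n = 0` contributes nothing since `m/0 = 0` and `C/0^p = 0`).  No new mathematics.
HONEST FRAMING: a measure bound for the known-irrational `π²`; nothing about `ζ(5)`.
-/

/-- Threshold form of `¬ LiouvilleWith p x` (Mathlib's definition, unfolded): for every `C` there is `N` such that for all
`n ≥ N` every integer `m` has `x = m/n` or `C / n^p ≤ |x − m/n|`. [folklore] -/
theorem exists_threshold_of_not_liouvilleWith {p x : ℝ} (h : ¬ LiouvilleWith p x) (C : ℝ) :
    ∃ N : ℕ, ∀ n : ℕ, N ≤ n → ∀ m : ℤ, x ≠ (m : ℝ) / n → C / (n : ℝ) ^ p ≤ |x - (m : ℝ) / n| := by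
  unfold LiouvilleWith at h
  push Not at h
  have hC := h C
  rw [Filter.eventually_atTop] at hC
  obtain ⟨N, hN⟩ := hC
  exact ⟨N, fun n hn m hm => hN n hn m hm⟩

/-- For a fixed positive denominator `n`, only finitely many integers `m` have `|x − m/n| < B`. [folklore] -/
theorem finite_int_near (x B : ℝ) {n : ℕ} (hn : 0 < n) :
    Set.Finite {m : ℤ | |x - (m : ℝ) / n| < B} := by
  have hn' : (0 : ℝ) < n := by exact_mod_cast hn
  refine (Set.finite_Icc (⌊(n : ℝ) * x - n * B⌋) (⌈(n : ℝ) * x + n * B⌉)).subset ?_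
  intro m hm
  simp only [Set.mem_setOf_eq] at hm
  rw [abs_sub_lt_iff] at hm
  obtain ⟨h1, h2⟩ := hm
  -- `x - m/n < B` and `m/n - x < B`; multiply by `n > 0`
  have e : (n : ℝ) * ((m : ℝ) / n) = m := by field_simp
  have h1' : (n : ℝ) * x - n * B < m := by
    have := mul_lt_mul_of_pos_left h1 hn'
    rw [mul_sub, e] at this; linarith
  have h2' : (m : ℝ) < (n : ℝ) * x + n * B := by
    have := mul_lt_mul_of_pos_left h2 hn'
    rw [mul_sub, e] at this; linarith
  refine Set.mem_Icc.2 ⟨?_, ?_⟩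
  · have : ((⌊(n : ℝ) * x - n * B⌋ : ℤ) : ℝ) < m := lt_of_le_of_lt (Int.floor_le _) h1'
    exact le_of_lt (by exact_mod_cast this)
  · have : (m : ℝ) < ((⌈(n : ℝ) * x + n * B⌉ : ℤ) : ℝ) := lt_of_lt_of_le h2' (Int.le_ceil _)
    exact le_of_lt (by exact_mod_cast this)

/-- From `¬ LiouvilleWith p x` with `p ≠ 0`: for every `C`, only finitely many pairs `(m, n) ∈ ℤ × ℕ` satisfy
`0 < |x − m/n| < C / n^p`. [folklore] -/
theorem finite_pairs_of_not_liouvilleWith {p x : ℝ} (hp : p ≠ 0) (h : ¬ LiouvilleWith p x) (C : ℝ) :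
    Set.Finite {q : ℤ × ℕ | 0 < |x - (q.1 : ℝ) / q.2| ∧ |x - (q.1 : ℝ) / q.2| < C / (q.2 : ℝ) ^ p} := by
  obtain ⟨N, hN⟩ := exists_threshold_of_not_liouvilleWith h C
  -- the pairs with `n < N`, `0 < n`
  have hfin : Set.Finite (⋃ n ∈ Finset.range N,
      (fun m : ℤ => (m, n)) '' {m : ℤ | |x - (m : ℝ) / n| < C / (n : ℝ) ^ p}) := by
    refine Set.Finite.biUnion (Finset.range N).finite_toSet fun n _ => ?_
    rcases Nat.eq_zero_or_pos n with rfl | hn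
    · -- n = 0: `m/0 = 0` and `C / 0^p = 0`, so the condition `|x| < 0` is never met
      refine (Set.finite_empty.subset ?_).image _
      intro m hm
      simp only [Set.mem_setOf_eq, Nat.cast_zero, div_zero, sub_zero, Real.zero_rpow hp] at hm
      exact absurd hm (not_lt.2 (abs_nonneg x))
    · exact (finite_int_near x _ hn).image _
  refine hfin.subset ?_
  rintro ⟨m, n⟩ ⟨hpos, hlt⟩
  simp only [Set.mem_iUnion, Set.mem_image, Set.mem_setOf_eq, Finset.mem_range, Prod.mk.injEq,
    exists_prop]
  have hne : x ≠ (m : ℝ) / n := fun hx => by simp [hx] at hpos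
  have hnN : n < N := by
    by_contra hge
    exact absurd hlt (not_lt.2 (hN n (not_lt.1 hge) m hne))
  exact ⟨n, hnN, m, hlt, rfl, rfl⟩

/-- **Theorem 1.1 of the write-up, second sentence, verbatim.**  For every real `p > 5.0205` and every `C`, only finitely many
pairs `(m, n) ∈ ℤ × ℕ` satisfy `0 < |π² − m/n| < C / n^p`.  From `pi_sq_not_liouvilleWith_D1` and Mathlib's definition of
`LiouvilleWith` alone; vocabulary: `Real.pi`, `Set.Finite`, numerals. -/
theorem pi_sq_finitely_many_approximations_D1 (p : ℝ) (hp : (5.0205 : ℝ) < p) (C : ℝ) :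
    Set.Finite {q : ℤ × ℕ | 0 < |Real.pi ^ 2 - (q.1 : ℝ) / q.2| ∧ |Real.pi ^ 2 - (q.1 : ℝ) / q.2| < C / (q.2 : ℝ) ^ p} :=
  finite_pairs_of_not_liouvilleWith (by linarith) (pi_sq_not_liouvilleWith_D1 p hp) C

/-- The same for `π²/6 = ζ(2)`. -/
theorem pi_sq_div_six_finitely_many_approximations_D1 (p : ℝ) (hp : (5.0205 : ℝ) < p) (C : ℝ) :
    Set.Finite {q : ℤ × ℕ | 0 < |Real.pi ^ 2 / 6 - (q.1 : ℝ) / q.2| ∧ |Real.pi ^ 2 / 6 - (q.1 : ℝ) / q.2| < C / (q.2 : ℝ) ^ p} :=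
  finite_pairs_of_not_liouvilleWith (by linarith) (pi_sq_div_six_not_liouvilleWith_D1 p hp) C

/-- **Threshold form** (the reading used in §9.1 of the write-up): for `p > 5.0205` and every `C` there is `N` with
`π² = m/n ∨ C/n^p ≤ |π² − m/n|` for all `n ≥ N`, `m ∈ ℤ`. -/
theorem pi_sq_approximation_threshold_D1 (p : ℝ) (hp : (5.0205 : ℝ) < p) (C : ℝ) :
    ∃ N : ℕ, ∀ n : ℕ, N ≤ n → ∀ m : ℤ, Real.pi ^ 2 = (m : ℝ) / n ∨ C / (n : ℝ) ^ p ≤ |Real.pi ^ 2 - (m : ℝ) / n| := by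
  obtain ⟨N, hN⟩ := exists_threshold_of_not_liouvilleWith (pi_sq_not_liouvilleWith_D1 p hp) C
  exact ⟨N, fun n hn m => (em _).imp_right (hN n hn m)⟩

end Summit.KontsevichZagierPeriods.Zeta5Search.TwoTaleD1Measure
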